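import Summits.CriticalPhenomena.PercolationContinuityZ3.Theorems.Transplant.TwoAxisBandStride
import HarnessLib

/-!
# Two-axis steering, X-c: the two-unit parameter lemma for an ENVELOPE of bands COMPARABLE to a reference band (the LEVEL-0 arithmetic of
# option C for the MULTI-TYPE D″ node)

builds on p205010 (kernel theorem, internal audit signed; external expert review pending) — nothing in this file uses p205010.
Lane `prim-bschramm`, seat `prim-bschramm-p4` (gen 8; PART C3, METHOD = abstract closing argument); helper file (`--supports stmt-CriticalPhenomena-4575
--as helper`).  Memo: `HOME/bschramm/P4-GENERAL.md` §21.4.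

WHY.  Step I′ of the D″ v2 closure over a skeleton with SEVERAL base types only yields the type-ENVELOPES `Gb = max_t G_t`, `Fb = max_t F_t⁻¹` of the
per-type bands, for which the two-unit pair need not exist (stmt-g9 2026-08-21T05:44:21Z, abstract counterexample) — whence the lane's option S (the
single-type node `SamePDropOfSkeletonSign₁` is the target of record) and the multi-type node `SamePDropOfSkeletonSign` (p244708) stays a conjecture; its
first lattice customer is the stacked kagome lattice (`KagomeZSign`, three types, no single-type height exists).  Option C (ibid.) repairs the envelope by
COMPARABILITY: frames and the Lipschitz property make every type's band `d`-comparable to a reference band (`G_t(ℓ) ≤ G_ref(ℓ + d) + d`,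
`F_t⁻¹(ℓ) ≤ F_ref⁻¹(ℓ + d) + d`, `d` = the inter-type offset).  This file is the ARITHMETIC half, once and for all: for ANY functions `Gb, Fb`
`d`-comparable (`d ≤ m`) to a monotone band, the conclusion of `exists_twoUnitL` holds with the unit ratio `A ≥ 4(L+1)c` in place of `2Lc`
(`exists_twoUnitL_of_comparable`) — apply `exists_twoUnitL` to the reference band with stride factor `L + 1`, separation `2c` and floor `max n₀ d`, and
absorb the offsets by `d ≤ e` (so `L e + d ≤ (L+1) e`) and `d ≤ m ≤ G_ref, F_ref⁻¹`.  The geometric half (the comparability itself, a re-seeding inside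
Step I′) is the design owner's; nothing below or above LEVEL 0 changes.
[cite: KozmaNitzan2024, §4 Lemma 11 pp. 22–23, Theorem 6 Step III p. 30] [cite: GrimmettPercolation1999, §7.3 Lemma (7.52) p. 170]
-/

noncomputable section

namespace Summit.CriticalPhenomena.PercolationContinuityZ3.Theorems.Transplant

namespace TwoAxis

open scoped Classical

variable {f g : ℕ → ℕ → ℝ} {τ : ℝ} {m : ℕ}

/-- **THE TWO-UNIT PARAMETER LEMMA FOR A COMPARABLE ENVELOPE.**  Let `(f, g)` be a monotone band at scale `m` and let `Gb, Fb : ℕ → ℕ` be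
`d`-comparable to its spreads (`Gb ℓ ≤ G(ℓ + d) + d`, `Fb ℓ ≤ F⁻¹(ℓ + d) + d` for `ℓ ≥ m`, with `d ≤ m`) — e.g. the type-envelopes of the bands of a
multi-type skeleton.  Then for every stride factor `L ≥ 1` with `2(L+1) + 1 ≤ m`, separation `c ≥ 1`, unit ratio `A ≥ 4(L+1)c` and floor `n₀` there
are extents `e_x, e_y ≥ max(n₀, m)` with `c · Gb(L e_x) ≤ A · e_y` and `c · Fb(L e_y) ≤ A · e_x`.
[cite: KozmaNitzan2024, §4 Lemma 11 pp. 22–23] -/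
theorem exists_twoUnitL_of_comparable (hb : IsMonotoneBand f g τ m) (Gb Fb : ℕ → ℕ) {d : ℕ} (hd : d ≤ m)
    (hG : ∀ ℓ, m ≤ ℓ → Gb ℓ ≤ bandG g τ m (ℓ + d) + d) (hF : ∀ ℓ, m ≤ ℓ → Fb ℓ ≤ bandFinv f τ m (ℓ + d) + d)
    {L : ℕ} (hL : 1 ≤ L) (hm : 2 * (L + 1) + 1 ≤ m) {c A : ℕ} (hc : 1 ≤ c) (hA : 4 * (L + 1) * c ≤ A) (n₀ : ℕ) :
    ∃ ex ey : ℕ, n₀ ≤ ex ∧ n₀ ≤ ey ∧ m ≤ ex ∧ m ≤ ey ∧ c * Gb (L * ex) ≤ A * ey ∧ c * Fb (L * ey) ≤ A * ex := by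
  have hA' : 2 * (L + 1) * (2 * c) ≤ A := by
    calc 2 * (L + 1) * (2 * c) = 4 * (L + 1) * c := by ring
      _ ≤ A := hA
  obtain ⟨ex, ey, hxn, hyn, hxm, hym, hGx, hFy⟩ :=
    exists_twoUnitL hb (L := L + 1) (by omega) hm (c := 2 * c) (by omega) hA' (max n₀ d)
  have hxd : d ≤ ex := (le_max_right _ _).trans hxn
  have hyd : d ≤ ey := (le_max_right _ _).trans hyn
  refine ⟨ex, ey, (le_max_left _ _).trans hxn, (le_max_left _ _).trans hyn, hxm, hym, ?_, ?_⟩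
  · -- `c · Gb(L e_x) ≤ c · (G(L e_x + d) + d) ≤ c · G((L+1) e_x) + c · G((L+1) e_x) ≤ A · e_y`
    have hLx : m ≤ L * ex := hxm.trans (Nat.le_mul_of_pos_left ex (by omega))
    have h1 := hG (L * ex) hLx
    have hle : L * ex + d ≤ (L + 1) * ex := by nlinarith
    have h2 : bandG g τ m (L * ex + d) ≤ bandG g τ m ((L + 1) * ex) := bandG_mono hb (by omega) hle
    have h3 : m ≤ bandG g τ m ((L + 1) * ex) := (bandG_spec hb (hLx.trans (by nlinarith))).1
    have h4 : c * Gb (L * ex) ≤ c * (bandG g τ m ((L + 1) * ex) + bandG g τ m ((L + 1) * ex)) :=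
      Nat.mul_le_mul_left c (by omega)
    calc c * Gb (L * ex) ≤ c * (bandG g τ m ((L + 1) * ex) + bandG g τ m ((L + 1) * ex)) := h4
      _ = 2 * c * bandG g τ m ((L + 1) * ex) := by ring
      _ ≤ A * ey := hGx
  · have hLy : m ≤ L * ey := hym.trans (Nat.le_mul_of_pos_left ey (by omega))
    have h1 := hF (L * ey) hLy
    have hle : L * ey + d ≤ (L + 1) * ey := by nlinarith
    have h2 : bandFinv f τ m (L * ey + d) ≤ bandFinv f τ m ((L + 1) * ey) := bandFinv_mono hb (by omega) hle
    have h3 : m ≤ bandFinv f τ m ((L + 1) * ey) := (bandFinv_spec hb (hLy.trans (by nlinarith))).1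
    have h4 : c * Fb (L * ey) ≤ c * (bandFinv f τ m ((L + 1) * ey) + bandFinv f τ m ((L + 1) * ey)) :=
      Nat.mul_le_mul_left c (by omega)
    calc c * Fb (L * ey) ≤ c * (bandFinv f τ m ((L + 1) * ey) + bandFinv f τ m ((L + 1) * ey)) := h4
      _ = 2 * c * bandFinv f τ m ((L + 1) * ey) := by ring
      _ ≤ A * ex := hFy

/-- **The envelope of finitely many comparable bands is comparable** (so `exists_twoUnitL_of_comparable` applies to `Gb = max m (sup_t G_t)`):
if every `G_t` (`t ∈ T`) is `d`-comparable to the reference spread, so is `ℓ ↦ max m (T.sup (G_· ℓ))`. [folklore] -/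
theorem envelope_comparable {ι : Type*} (T : Finset ι) (Gt : ι → ℕ → ℕ) (Gref : ℕ → ℕ) {d m : ℕ}
    (href : ∀ ℓ, m ≤ ℓ → m ≤ Gref (ℓ + d)) (h : ∀ t ∈ T, ∀ ℓ, m ≤ ℓ → Gt t ℓ ≤ Gref (ℓ + d) + d) (ℓ : ℕ) (hℓ : m ≤ ℓ) :
    max m (T.sup fun t => Gt t ℓ) ≤ Gref (ℓ + d) + d := by
  refine max_le ((href ℓ hℓ).trans (Nat.le_add_right _ _)) ?_
  exact Finset.sup_le fun t ht => h t ht ℓ hℓ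

end TwoAxis

end Summit.CriticalPhenomena.PercolationContinuityZ3.Theorems.Transplant

end
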